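import Literature.ModelTheory.FiniteModelTheory.ColouringCodes
import Literature.ModelTheory.FiniteModelTheory.CohomologicalConsistencyMarginals
import HarnessLib

/-!
# Ideal reduction fools cohomological `k`-consistency for `3`-colourability
# (Conneryd–Ghannane–Pang 2025, Lemma 4.4 for `CSP(K₃)`, over `ℤ`)

Topic `Literature/ModelTheory/FiniteModelTheory`.  The deterministic engine of the proof of the
named fact `connerydGhannanePang2025_thm_6_1` (`CohomologicalConsistencyThreeColouring.lean`):
the Alekhnovich–Razborov reduction operator attached to a closure map `cl` on vertex sets makes a
graph `G` cohomologically `k`-consistent w.r.t. `K₃` (Ó Conghaile's Definition 5, tree notion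
`GraphCohomologicallyKConsistent k G ⊤`) as soon as the REDUCIBILITY CONDITION holds — PROVED
here (`graphCohomologicallyKConsistent_of_reducible`), all algebra over `ℤ`.

## The mathematics (arXiv:2511.17272 §2.5, §3, §4, §6 and Appendix A, specialised to `CSP(K₃)`)

Variables `x_{v,i}` (`v ∈ V(G)`, `i ∈ [3]`) are numbered by an arbitrary bijection
`enc : V × Fin 3 ≃ Fin N`; the order only matters for VERIFYING reducibility, not here.  For a
vertex set `W` let `𝒱_W ⊆ {0,1}^N` (`pts G enc W`) be the `0/1` vectors whose `W`-part is the
indicator vector of a proper `3`-colouring of `G[W]` (exactly one colour per vertex of `W`, no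
monochromatic edge inside `W`), the other coordinates being free; its vanishing ideal `I(𝒱_W)`
plays the role of `⟨W⟩ = ⟨P_{G[W] → K₃}⟩` (same normal forms on `W`-supported polynomials).  For a
context `U` and `ψ : U → [3]` put `m_ψ = ∏_{u ∈ U} x_{u,ψ u}` (`mono`) and

  `ρ_U(ψ) := R_{I(𝒱_{cl U})}(m_ψ) ∈ ℤ[x]`   (`rho`; the integral lex normal form of
  `BooleanLexNormalForm.lean`, i.e. `R(m_ψ)` for the operator `R` of Lemma 4.2).

Then the four hypotheses of `graphCohomologicallyKConsistent_of_marginals`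
(`CohomologicalConsistencyMarginals.lean` = Lemma 3.1 + proof of Lemma 4.4) hold:
* SUPPORT (`proper_of_rho_ne_zero`): `ρ_U(ψ) ≠ 0 ⇒ ψ` proper — an improper `m_ψ` vanishes on
  `𝒱_{cl U}` (`U ⊆ cl U`), so reduces to `0` [§3, first paragraph of the proof of Lemma 3.1];
* MARGINALS (`sum_rho_extendAt`): `∑_b ρ_U(ψ[a ↦ b]) = R_{cl U}((∑_b x_{a,b}) m_ψ) = R_{cl U}(m_ψ)`
  (`∑_b x_{a,b} - 1 ∈ I(𝒱_{cl U})`) `= R_{cl(U∖a)}(m_ψ) = ρ_{U∖a}(ψ)`, the last step being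
  Claim A.3: `R_{cl(U∖a)}(m_ψ)` is `cl(U∖a)`-supported (Claim A.2, `support_normalForm_subset`,
  proved by killing the outside variables) hence, BY REDUCIBILITY, reduced modulo the larger
  ideal, so the two normal forms agree (`normalForm_eq_normalForm_of_isReduced`);
* SEPARATION (`rho_separated`): if `ρ_C(φ) ≠ 0` then `m_φ ∉ I(𝒱_{cl C})`, so some code
  `y ∈ 𝒱_{cl C}` extends `φ`; `h = eval_y` gives `h(ρ_C φ) = m_φ(y) = 1` and `h(ρ_C ψ) = m_ψ(y) = 0`
  for `ψ ≠ φ` [proof of Lemma 4.4; the extension exists here without appeal to consistency];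
* NON-EMPTINESS (`rho_empty_ne_zero`): `ρ_∅ = R(1) = 1` as `G[cl ∅]` is `3`-colourable.

REDUCIBILITY is asked in the integral leading-exponent language of `BooleanLexMonic.lean`: for
`|U| ≤ k`, `a ∈ U`, every exponent supported on the variables of `cl(U∖a)` that is the leading
exponent of a monic integer polynomial vanishing on `𝒱_{cl U}` is one for `𝒱_{cl(U∖a)}`; with
`cl(U∖a) ⊆ cl U`.  (This follows from the reducibility condition of Lemma 4.2 for a closure
operator, and is what [CdRNPR25, Lemma 6.5] = Lemma 6.8 provides for sparse graphs; NOT here.)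

## References

* [ConnerydGhannanePang2025] arXiv:2511.17272, §2.5 (encoding), Lemma 3.1, Lemma 4.2, Lemma 4.4,
  App. A (Claims A.2, A.3). READ.
* [OConghaile2022] Definition 5 (the tree notion `GraphCohomologicallyKConsistent`).
-/

noncomputable section

open MvPolynomial Finset
open Literature.RingTheory.MvPolynomial

namespace Literature.ModelTheory.FiniteModelTheory

namespace ConnerydGhannanePang

variable {V : Type*} [DecidableEq V] {G : SimpleGraph V} {N : ℕ} {enc : V × Fin 3 ≃ Fin N}

section Weights

/-! ### The Alekhnovich–Razborov weights and the four hypotheses -/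

variable (G enc) in
/-- THE WEIGHTS `ρ_U(ψ) = R_{I(𝒱_{cl U})}(m_ψ)`: the reduction of the monomial of `ψ` modulo the
colouring ideal of the closure of its context (the value `R(m_ψ)` of the Alekhnovich–Razborov
operator of Lemma 4.2, over `ℤ`). [cite: ConnerydGhannanePang2025, Lemma 4.2] -/
def rho (cl : Finset V → Finset V) (U : Finset V) (ψ : ↥U → Fin 3) : MvPolynomial (Fin N) ℤ :=
  normalForm (pts G enc (cl U)) (mono enc U ψ)

variable {cl : Finset V → Finset V}

/-- SUPPORT: non-zero weight forces a proper partial colouring (an improper `m_ψ` vanishes on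
`𝒱_{cl U}` as `U ⊆ cl U`). [cite: ConnerydGhannanePang2025, Lemma 3.1 (proof, first paragraph)] -/
theorem proper_of_rho_ne_zero (hself : ∀ U : Finset V, U ⊆ cl U) {U : Finset V} {ψ : ↥U → Fin 3}
    (h : rho G enc cl U ψ ≠ 0) (u v : ↥U) (huv : G.Adj u v) :
    (⊤ : SimpleGraph (Fin 3)).Adj (ψ u) (ψ v) := by
  rw [SimpleGraph.top_adj]
  intro heq
  refine h (normalForm_of_mem (isZeroOne_pts _) fun y hy => ?_)
  rw [eval_mono]
  have hu1 : totalize ψ u = ψ u := totalize_of_mem ψ u.2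
  have hv1 : totalize ψ v = ψ v := totalize_of_mem ψ v.2
  by_cases hyu : y (enc (u, totalize ψ u)) = 1
  · refine Finset.prod_eq_zero v.2 ?_
    rcases (mem_pts.1 hy).1 (enc (v, totalize ψ v)) with h0 | h1
    · exact h0
    · exact ((mem_pts.1 hy).2.2 u (hself U u.2) v (hself U v.2) huv (ψ u) (hu1 ▸ hyu)
        (by rw [heq, ← hv1]; exact h1)).elim
  · refine Finset.prod_eq_zero u.2 ?_
    rcases (mem_pts.1 hy).1 (enc (u, totalize ψ u)) with h0 | h1
    · exact h0
    · exact absurd h1 hyu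

/-- SEPARATION: a non-zero `ρ_C(φ)` is separated from the other `ρ_C(ψ)` by the evaluation at
a code `y ∈ 𝒱_{cl C}` extending `φ` (which exists because `m_φ ∉ I(𝒱_{cl C})`):
`m_φ(y) = 1`, `m_ψ(y) = 0`. [cite: ConnerydGhannanePang2025, Lemma 4.4 (proof)] -/
theorem rho_separated (hself : ∀ U : Finset V, U ⊆ cl U) {C : Finset V} {φ : ↥C → Fin 3}
    (h : rho G enc cl C φ ≠ 0) :
    ∃ hh : MvPolynomial (Fin N) ℤ →+ ℤ, hh (rho G enc cl C φ) = 1 ∧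
      ∀ ψ : ↥C → Fin 3, ψ ≠ φ → hh (rho G enc cl C ψ) = 0 := by
  -- a code extending `φ`
  obtain ⟨y, hy, hyφ⟩ : ∃ y ∈ pts G enc (cl C), eval y (mono enc C φ) ≠ 0 := by
    by_contra hall
    push Not at hall
    exact h (normalForm_of_mem (isZeroOne_pts _) hall)
  rw [eval_mono, Finset.prod_ne_zero_iff] at hyφ
  have hy1 : ∀ c ∈ C, y (enc (c, totalize φ c)) = 1 := fun c hc =>
    ((mem_pts.1 hy).1 _).resolve_left (hyφ c hc)
  refine ⟨AddMonoidHom.mk' (fun p => eval y p) fun p q => map_add _ p q, ?_, fun ψ hψ => ?_⟩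
  · show eval y (rho G enc cl C φ) = 1
    rw [rho, eval_normalForm _ _ hy, eval_mono]
    exact Finset.prod_eq_one hy1
  · show eval y (rho G enc cl C ψ) = 0
    rw [rho, eval_normalForm _ _ hy, eval_mono]
    obtain ⟨c, hc⟩ : ∃ c : ↥C, ψ c ≠ φ c := by
      by_contra hall
      push Not at hall
      exact hψ (funext hall)
    refine Finset.prod_eq_zero c.2 ?_
    rw [totalize_of_mem ψ c.2]
    exact code_eq_zero_of_ne hy (hself C c.2) ((totalize_of_mem φ c.2) ▸ hy1 c c.2) hc

/-- NON-EMPTINESS: `ρ_∅ = R(1) = 1 ≠ 0` when `G[cl ∅]` has a proper `3`-colouring.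
[cite: ConnerydGhannanePang2025, App. A (proof of `R(1) = 1`)] -/
theorem rho_empty_ne_zero (hsat : ∃ c : V → Fin 3, ∀ u ∈ cl ∅, ∀ v ∈ cl ∅, G.Adj u v → c u ≠ c v)
    (θ : ↥(∅ : Finset V) → Fin 3) : rho G enc cl ∅ θ ≠ 0 := by
  obtain ⟨c, hc⟩ := hsat
  rw [rho, mono_empty, normalForm_one (isZeroOne_pts _) ⟨_, codeOf_mem_pts hc⟩]
  exact one_ne_zero

end Weights

section Marginal

variable {cl : Finset V → Finset V}

/-- `m_{ψ[a ↦ b]} = x_{a,b} · m_ψ`. [folklore] -/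
theorem mono_extendAt {U : Finset V} {a : V} (ha : a ∈ U) (ψ : ↥(U.erase a) → Fin 3) (b : Fin 3) :
    mono enc U (SectionSystem.extendAt ψ b) = X (enc (a, b)) * mono enc (U.erase a) ψ := by
  unfold mono
  rw [← Finset.mul_prod_erase U _ ha, totalize_of_mem _ ha, SectionSystem.extendAt_apply_self]
  congr 1
  refine Finset.prod_congr rfl fun u hu => ?_
  have hu' : u ∈ U := Finset.mem_of_mem_erase hu
  have hne : u ≠ a := Finset.ne_of_mem_erase hu
  rw [totalize_of_mem _ hu', totalize_of_mem _ hu,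
    SectionSystem.extendAt_apply_of_ne ψ b ⟨u, hu'⟩ hne]

/-- MARGINALS, first half: `∑_b ρ_U(ψ[a ↦ b]) = R_{cl U}(m_ψ)` (`∑_b x_{a,b} ≡ 1` modulo
`I(𝒱_{cl U})` since `a ∈ U ⊆ cl U`). [cite: ConnerydGhannanePang2025, Lemma 3.1 (extendability)] -/
theorem sum_rho_extendAt_eq (hself : ∀ U : Finset V, U ⊆ cl U) {U : Finset V} {a : V} (ha : a ∈ U)
    (ψ : ↥(U.erase a) → Fin 3) :
    ∑ b : Fin 3, rho G enc cl U (SectionSystem.extendAt ψ b) =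
      normalForm (pts G enc (cl U)) (mono enc (U.erase a) ψ) := by
  unfold rho
  simp_rw [mono_extendAt ha ψ]
  rw [← normalForm_sum (isZeroOne_pts _), ← Finset.sum_mul]
  refine normalForm_congr (isZeroOne_pts _) fun y hy => ?_
  rw [map_sub, map_mul, map_sum, sub_eq_zero]
  simp_rw [eval_X]
  rw [sum_code_eq_one hy (hself U ha), one_mul]

/-- MARGINALS (the one-step marginal identity `∑_b ρ_U(ψ[a ↦ b]) = ρ_{U∖a}(ψ)`) FROM
REDUCIBILITY: `R_{cl U}(m_ψ) = R_{cl(U∖a)}(m_ψ)` because the latter is `cl(U∖a)`-supported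
(Claim A.2) and therefore, by the reducibility hypothesis, reduced modulo the larger ideal
`I(𝒱_{cl U})` (Claim A.3). [cite: ConnerydGhannanePang2025, Lemma 4.2 and App. A, Claim A.3] -/
theorem sum_rho_extendAt (hself : ∀ U : Finset V, U ⊆ cl U) {U : Finset V} {a : V} (ha : a ∈ U)
    (hmono : cl (U.erase a) ⊆ cl U)
    (hred : ∀ α : Fin N →₀ ℕ, (∀ j ∈ α.support, (enc.symm j).1 ∈ cl (U.erase a)) →
      α ∈ monicExponents (pts G enc (cl U)) → α ∈ monicExponents (pts G enc (cl (U.erase a))))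
    (ψ : ↥(U.erase a) → Fin 3) :
    ∑ b : Fin 3, rho G enc cl U (SectionSystem.extendAt ψ b) = rho G enc cl (U.erase a) ψ := by
  rw [sum_rho_extendAt_eq hself ha]
  unfold rho
  refine normalForm_eq_normalForm_of_isReduced (isZeroOne_pts _) (pts_antitone hmono) ?_
  intro α hα hmonic
  have hsupp : ∀ j ∈ α.support, (enc.symm j).1 ∈ cl (U.erase a) := fun j hj =>
    support_normalForm_subset (fun β hβ j' hj' =>
      hself _ (fst_mem_of_mem_support_mono ψ hβ hj')) hα hj
  exact isReduced_normalForm _ _ α hα (hred α hsupp hmonic)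

/-- **Ideal reduction fools cohomological `k`-consistency for `3`-colourability** (Conneryd–
Ghannane–Pang, Lemma 4.4 for `CSP(K₃)`, with Lemmas 3.1, 4.2 and Appendix A behind it, all over
`ℤ`).  Let `cl` be a map on vertex sets with `U ⊆ cl U`, `cl(U∖a) ⊆ cl U` for `|U| ≤ k`, `G[cl ∅]`
properly `3`-colourable, and satisfying REDUCIBILITY: for `|U| ≤ k` and `a ∈ U`, every exponent
supported on the variables of `cl(U∖a)` that is the leading exponent of a monic integer
polynomial vanishing on the codes `𝒱_{cl U}` is already one for `𝒱_{cl(U∖a)}`.  Then `G` is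
cohomologically `k`-consistent with respect to `K₃` (Ó Conghaile's Definition 5): the weights
`ρ_U(ψ) = R_{I(𝒱_{cl U})}(m_ψ)` satisfy the hypotheses of
`graphCohomologicallyKConsistent_of_marginals`. [cite: ConnerydGhannanePang2025, Lemma 4.4] -/
theorem graphCohomologicallyKConsistent_of_reducible [Fintype V] (k : ℕ) (cl : Finset V → Finset V)
    (hself : ∀ U : Finset V, U ⊆ cl U)
    (hmono : ∀ U : Finset V, U.card ≤ k → ∀ a ∈ U, cl (U.erase a) ⊆ cl U)
    (hsat : ∃ c : V → Fin 3, ∀ u ∈ cl ∅, ∀ v ∈ cl ∅, G.Adj u v → c u ≠ c v)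
    (hred : ∀ U : Finset V, U.card ≤ k → ∀ a ∈ U, ∀ α : Fin N →₀ ℕ,
      (∀ j ∈ α.support, (enc.symm j).1 ∈ cl (U.erase a)) →
      α ∈ monicExponents (pts G enc (cl U)) → α ∈ monicExponents (pts G enc (cl (U.erase a)))) :
    GraphCohomologicallyKConsistent k G (⊤ : SimpleGraph (Fin 3)) :=
  graphCohomologicallyKConsistent_of_marginals k G ⊤ (rho G enc cl)
    (fun _ _ _ h => proper_of_rho_ne_zero hself h)
    (fun U a ha hU ψ => sum_rho_extendAt hself ha (hmono U hU a ha) (hred U hU a ha) ψ)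
    (fun _ _ _ h => rho_separated hself h)
    ⟨∅, fun x => (Finset.notMem_empty x.1 x.2).elim, Nat.zero_le _, rho_empty_ne_zero hsat _⟩

end Marginal

end ConnerydGhannanePang

end Literature.ModelTheory.FiniteModelTheory
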